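import Summits.BirchSwinnertonDyer.BirchSwinnertonDyer.Theorems.SchneiderFreeAdditiveX3PotMultBranchIMCOfLowerHalves
import Summits.BirchSwinnertonDyer.BirchSwinnertonDyer.Theorems.AdditiveBranchIMCMultLowerOfParts
import Summits.BirchSwinnertonDyer.Rank1Residual.Additive.AnticycJointLower
import HarnessLib

/-!
# Route `SchneiderFreeAdditiveX3` (rung K1 door), crux `PotMultBranchIMC` (item stmt-BirchSwinnertonDyer-19176):
# CROSS-ROUTE PLACEMENT — the crux is implied by bsd-addord's crux `MultLower` (item 19359) and by
# team n1011's typed Heegner input, modulo the control crux and print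

Cell `bsd-schneider-ideate`, seat `bsd-schneider-door-c2` (prover, generation 4). HONEST FRAMING:
propositional bookkeeping between typed statements of THREE cells on the same census cell (M) (odd
additive potentially multiplicative `p`, `E[p]` reducible); NOTHING is asserted about elliptic curves;
every hypothesis below is an open conjecture, a cite-only printed fact, or another route's open item;
BSD is not advanced by this file; it is `--supports` material for item 19176 (ladder DAG edges in
kernel form, continuing g3's `…PotMultBranchIMCOfLowerHalves`).

## What is kernel-checked here

* §1 **edge to route `AdditiveBranchIMC` (cell bsd-addord).** Its crux `MultLower` (item 19359:
  `∀ W p, r_an ≤ 1 → N10.CellM W p → MissingLowerBoundAt W p`, the lower half of BSD_p on ALL of cell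
  (M), both ranks, X3 and X4) restricts to the two lower halves g3's `stepL_subM_of_lowerHalves`
  consumes (`lowerHalves_subM_of_multLower`); hence `PrintedFacts + AnticycControlAdditiveK + MultLower
  ⟹ PotMultBranchIMC` BY NAME (`potMultBranchIMC_of_printedFacts_of_control_of_multLower`), and — through
  bsd-addord's PROVED glue `MultLowerOfParts` (item 19593, `multLowerOfParts_proof`) — the Schneider-free
  crux r2 follows from the seven inputs of the CYCLOTOMIC (M) road (`DelbourgoPotMultUnit`,
  `PalQuadraticTwistPeriod`, `DelbourgoLeadingTermPotMult`, `MultModularityInputs`, `MultLambdaLower`,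
  `MultSchneiderNondegeneracy`, `MultBranchPAdicGrossZagierAt`) plus control and print
  (`potMultBranchIMC_of_printedFacts_of_control_of_multLowerParts`). Conversely
  (`multLower_red_rankOne_of_printedFacts_of_cruxes`) r2 + r4 + `PrintedFacts` give `MultLower` back on
  its reducible rank-one rows (g3 §3 in `MultLower`'s binder shape).
* §2 **edge to team n1011's route r3** (`Additive/AnticycJointLower.lean`): the typed missing input
  `Route3Anticyc.HeegnerInputAt W p` (joint lower half over `(W, W^{d_K})` for EVERY imaginary quadratic
  `K` Heegner for `N_W` with `p` split) at the reducible rank-one (M) pairs gives STEP L Manin-robust on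
  (M) (`stepL_subM_of_heegnerInput`, via g3's converse of `JointLowerManin`), hence r2 BY NAME
  (`potMultBranchIMC_of_printedFacts_of_control_of_heegnerInput`); conversely r2 + r4 + print give the
  joint lower half at every door datum (`jointLowerBoundAt_of_printedFacts_of_cruxes_at_datum`: the
  fields of the door — odd `d_K`, `p ∤ #𝓞_K^×`, `L(E^{d_K},1) ≠ 0` — not every field of `HeegnerInputAt`).

Net (ladder DAG, kernel form): modulo `PrintedFacts` and control, crux r2 of the K1 door ≤ crux
`MultLower` of K1 (addord) and ≤ n1011's `HeegnerInputAt` on X3 ∧ (M) ∧ `r_an = 1`; with g3: r2 ≥ the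
rung leaf on (M) = `MultLower`'s reducible rank-one rows.

References: Jetchev–Skinner–Wan, Camb. J. Math. 5 (2017) §7.4.1 (arXiv:1512.06894 pp. 29–31);
Miller, LMS J. Comput. Math. 14 (2011) Def. 1.1; Gross 1991 Thm. 1.3 (Kolyvagin); Delbourgo,
Compositio 113 (1998) Main Conjecture p. 151 (the (M)-measure, shape only).
-/

noncomputable section

open scoped Classical

open WeierstrassCurve NumberField IsDedekindDomain Field
  Literature.NumberTheory.EllipticCurves
  Literature.NumberTheory.EllipticCurves.ModularForms
  Literature.NumberTheory.EllipticCurves.GreenbergSelmer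
  Literature.NumberTheory.EllipticCurves.Rank1Residual
  Literature.NumberTheory.EllipticCurves.Rank1Residual.Typed
  Summit.BirchSwinnertonDyer.Rank1Residual
  Summit.BirchSwinnertonDyer.Rank1Residual.X11b
  Summit.BirchSwinnertonDyer.Rank1Residual.X11b.AcSelmer
  Summit.BirchSwinnertonDyer.Rank1Residual.X11b.Halves
  Summit.BirchSwinnertonDyer.BirchSwinnertonDyer.Theses.SchneiderFreeAdditiveX3

-- D-0017 layout: summit = sub-problem, so `Summit.BirchSwinnertonDyer.BirchSwinnertonDyer.…` is the
-- mandated namespace (same option as the route's sockets files).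
set_option linter.dupNamespace false
set_option autoImplicit false

namespace Summit.BirchSwinnertonDyer.BirchSwinnertonDyer.Theorems.SchneiderFree

/-! ## §1 Edge to bsd-addord's crux `MultLower` (route `AdditiveBranchIMC`, item 19359) -/

/-- **`MultLower` restricts to the two lower halves on the reducible (M) rows**: the binder shape of
bsd-addord's crux `MultLower` (`r_an ≤ 1`, `N10.CellM = p ≠ 2 ∧ Addv ∧ PotMult`) gives the lower half
at every reducible rank-ONE (M) pair (`ClassX3 = Red ∧ Addv`, `SubM = PotMult`) and the tree
conjecture `Additive.N10.LowerHalfM` (rank ZERO). Propositional. [folklore] -/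
theorem lowerHalves_subM_of_multLower
    (hML : ∀ (W : WeierstrassCurve ℚ) [W.IsElliptic] [W.IsGloballyMinimal] (p : ℕ) [Fact p.Prime],
      W.analyticRank ≤ 1 → Additive.N10.CellM W p → MissingLowerBoundAt W p) :
    (∀ (W : WeierstrassCurve ℚ) [W.IsElliptic] [W.IsGloballyMinimal] (p : ℕ) [Fact p.Prime],
      W.analyticRank = 1 → p ≠ 2 → ClassX3 W p → Additive.SubM W p → MissingLowerBoundAt W p) ∧
    Additive.N10.LowerHalfM :=
  ⟨fun W _ _ p _ hr hp2 hX hM ↦ hML W p hr.le ⟨hp2, hX.2, hM⟩,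
    fun W _ _ p _ hr hc ↦ hML W p (by omega) hc⟩

/-- **`PotMultBranchIMC` (BY NAME) ⇐ GZ, KO, GZK, MOD, GZ73 + the control crux + the binder shape of
bsd-addord's `MultLower`.** Composition of `lowerHalves_subM_of_multLower` with g3's
`potMultBranchIMC_of_control_of_lowerHalves`. CONDITIONAL on every displayed hypothesis (the last two
are open); closes nothing; BSD is not proved by any of this.
[cite: JetchevSkinnerWan2017, §7.4.1 (arXiv:1512.06894 p. 30)] [cite: Gross1991, Thm. 1.3] -/
theorem potMultBranchIMC_of_control_of_multLowerShape
    (hGZ : ∀ (N : ℕ) [NeZero N] (W : WeierstrassCurve ℚ) (K : Type) [Field K] [NumberField K],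
      gross_zagier N W K)
    (hKo : ∀ (N : ℕ) [NeZero N] (W : WeierstrassCurve ℚ) (K : Type) [Field K] [NumberField K],
      kolyvagin N W K)
    (hGZK : rank_eq_analyticRank_of_analyticRank_le_one) (hmod : hasEntireLFunction_rat)
    (hGZ73 : GrossZagier1986_thm_I_7_3)
    (h4 : AnticycControlAdditiveK)
    (hML : ∀ (W : WeierstrassCurve ℚ) [W.IsElliptic] [W.IsGloballyMinimal] (p : ℕ) [Fact p.Prime],
      W.analyticRank ≤ 1 → Additive.N10.CellM W p → MissingLowerBoundAt W p) :
    PotMultBranchIMC :=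
  potMultBranchIMC_of_control_of_lowerHalves hGZ hKo hGZK hmod hGZ73 h4
    (lowerHalves_subM_of_multLower hML).1 (lowerHalves_subM_of_multLower hML).2

/-- **Ladder DAG edge, kernel form: `PrintedFacts + AnticycControlAdditiveK + MultLower ⟹
PotMultBranchIMC`** — crux r2 of route `SchneiderFreeAdditiveX3` (item 19176) follows from crux
`MultLower` of route `AdditiveBranchIMC` (item 19359, cell bsd-addord; the lower half of BSD_p on the
whole cell (M), both ranks, reducible and irreducible) modulo the door's control crux and printed facts.
CONDITIONAL (three open hypotheses); closes nothing; BSD is not proved by any of this.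
[cite: JetchevSkinnerWan2017, §7.4.1 (arXiv:1512.06894 p. 30)] [cite: Miller2011LMS, Def. 1.1] -/
theorem potMultBranchIMC_of_printedFacts_of_control_of_multLower (hF : PrintedFacts)
    (h4 : AnticycControlAdditiveK)
    (hML : Summit.BirchSwinnertonDyer.BirchSwinnertonDyer.Theses.AdditiveBranchIMC.MultLower) :
    PotMultBranchIMC :=
  potMultBranchIMC_of_control_of_multLowerShape hF.1 hF.2.1 hF.2.2.1 hF.2.2.2.1 hF.2.2.2.2.2.2.1 h4 hML

/-- **The Schneider-free (M) crux from the CYCLOTOMIC (M) road's inputs.** Through bsd-addord's PROVED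
glue `MultLowerOfParts` (item 19593, `multLowerOfParts_proof`), the seven inputs of route
`AdditiveBranchIMC`'s (M) road — Delbourgo 1998 Prop. 4 unit form, Pal's twist-period fact,
Delbourgo 2002's leading term, the modularity inputs, the `Λ`-adic lower containment on the
`ω^{(p−1)/2}`-branch (`MultLambdaLower`, OPEN), Schneider non-degeneracy on (M) (`MultSchneiderNondegeneracy`,
OPEN) and the branch `p`-adic Gross–Zagier formula (`MultBranchPAdicGrossZagierAt`, OPEN) — together
with `PrintedFacts` and the control crux give `PotMultBranchIMC`. So the height-free crux r2 is AT MOST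
as strong as the Schneider road's open inputs on (M) (plus control). CONDITIONAL; closes nothing; BSD
is not proved by any of this. [cite: Delbourgo1998, Main Conjecture (p. 151) (shape only)]
[cite: JetchevSkinnerWan2017, §7.4.1 (arXiv:1512.06894 p. 30)] -/
theorem potMultBranchIMC_of_printedFacts_of_control_of_multLowerParts (hF : PrintedFacts)
    (h4 : AnticycControlAdditiveK)
    (h₁ : Summit.BirchSwinnertonDyer.BirchSwinnertonDyer.Theses.AdditiveBranchIMC.DelbourgoPotMultUnit)
    (h₂ : Summit.BirchSwinnertonDyer.BirchSwinnertonDyer.Theses.AdditiveBranchIMC.PalQuadraticTwistPeriod)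
    (h₃ : Summit.BirchSwinnertonDyer.BirchSwinnertonDyer.Theses.AdditiveBranchIMC.DelbourgoLeadingTermPotMult)
    (h₄ : Summit.BirchSwinnertonDyer.BirchSwinnertonDyer.Theses.AdditiveBranchIMC.MultModularityInputs)
    (h₅ : Summit.BirchSwinnertonDyer.BirchSwinnertonDyer.Theses.AdditiveBranchIMC.MultLambdaLower)
    (h₆ : Summit.BirchSwinnertonDyer.BirchSwinnertonDyer.Theses.AdditiveBranchIMC.MultSchneiderNondegeneracy)
    (h₇ : Summit.BirchSwinnertonDyer.BirchSwinnertonDyer.Theses.AdditiveBranchIMC.MultBranchPAdicGrossZagierAt) :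
    PotMultBranchIMC :=
  potMultBranchIMC_of_printedFacts_of_control_of_multLower hF h4
    (Summit.BirchSwinnertonDyer.BirchSwinnertonDyer.Theorems.AdditiveBranchIMCMultLower.multLowerOfParts_proof
      h₁ h₂ h₃ h₄ h₅ h₆ h₇)

/-- **What r2 gives back to `MultLower`: its reducible rank-one rows.** `PrintedFacts + PotMultBranchIMC
+ AnticycControlAdditiveK ⟹ MissingLowerBoundAt W p` at every pair of cell (M) (`N10.CellM`) of analytic
rank one with `E[p]` reducible (`Red W p`) — g3's `missingLowerBoundAt_subM_of_printedFacts_of_cruxes` in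
the binder shape of bsd-addord's crux (`ClassX3 = Red ∧ Addv`, `SubM = PotMult`). The rank-zero rows
and the irreducible (X4) rows of `MultLower` are NOT reached. CONDITIONAL; closes nothing.
[cite: JetchevSkinnerWan2017, §7.4.1 (arXiv:1512.06894 p. 30)] [cite: Miller2011LMS, Def. 1.1] -/
theorem multLower_red_rankOne_of_printedFacts_of_cruxes (hF : PrintedFacts) (h2 : PotMultBranchIMC)
    (h4 : AnticycControlAdditiveK) :
    ∀ (W : WeierstrassCurve ℚ) [W.IsElliptic] [W.IsGloballyMinimal] (p : ℕ) [Fact p.Prime],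
      W.analyticRank = 1 → Additive.N10.CellM W p → Red W p → MissingLowerBoundAt W p :=
  fun W _ _ p _ hr hc hred ↦
    missingLowerBoundAt_subM_of_printedFacts_of_cruxes hF h2 h4 W p hr hc.1 ⟨hred, hc.2.1⟩ hc.2.2

/-! ## §2 Edge to team n1011's typed Heegner input (`Additive/AnticycJointLower.lean`, route r3) -/

/-- **STEP L (Manin-robust) on the reducible (M) rows from n1011's `HeegnerInputAt`.** GZ, KO, GZK, MOD,
GZ73 (binders) + the typed missing input `Route3Anticyc.HeegnerInputAt W p` (joint lower half over
`(W, W^{d_K})` for every imaginary quadratic `K` Heegner for `N_W` with `p` split, every globally minimal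
model of the twist of analytic rank zero) at every reducible rank-one (M) pair ⟹
`AdditiveStepLInputManinAt W p` there: for a door datum over `K` (`p ∣ N_W` since `p` is additive, so
`p` splits by the Heegner hypothesis, `SatisfiesHeegnerHypothesis.of_dvd`), take a globally minimal model
`Wd` of `E^{d_K}` (`r_an(Wd) = 0` from `L(E^{d_K},1) ≠ 0`), read the joint lower half off the input and
convert it to STEP L over `K` at slack `v_p(c)` by g3's converse of `JointLowerManin`
(`indexLowerBoundLeAt_of_jointLowerBoundAt`). CONDITIONAL; nothing asserted.
[cite: JetchevSkinnerWan2017, §7.4.1 (arXiv:1512.06894 pp. 29–31)] [cite: Miller2011LMS, Def. 1.1] -/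
theorem stepL_subM_of_heegnerInput
    (hGZ : ∀ (N : ℕ) [NeZero N] (W : WeierstrassCurve ℚ) (K : Type) [Field K] [NumberField K],
      gross_zagier N W K)
    (hKo : ∀ (N : ℕ) [NeZero N] (W : WeierstrassCurve ℚ) (K : Type) [Field K] [NumberField K],
      kolyvagin N W K)
    (hGZK : rank_eq_analyticRank_of_analyticRank_le_one) (hmod : hasEntireLFunction_rat)
    (hGZ73 : GrossZagier1986_thm_I_7_3)
    (hIn : ∀ (W : WeierstrassCurve ℚ) [W.IsElliptic] [W.IsGloballyMinimal] (p : ℕ) [Fact p.Prime],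
      W.analyticRank = 1 → p ≠ 2 → ClassX3 W p → Additive.SubM W p →
        Additive.Route3Anticyc.HeegnerInputAt W p) :
    ∀ (W : WeierstrassCurve ℚ) [W.IsElliptic] [W.IsGloballyMinimal] (p : ℕ) [Fact p.Prime],
      W.analyticRank = 1 → p ≠ 2 → ClassX3 W p → Additive.SubM W p →
        AdditiveStepLInputManinAt W p := by
  intro W _ _ p _ hr hp2 hX hM N _ K _ _ Dt H ι P hr' _hloc hN hK hodd hunit hHe hLt hP _hnt
  -- a globally minimal model of the twist, of analytic rank zero
  have hD0 : (NumberField.discr K : ℚ) ≠ 0 := by exact_mod_cast NumberField.discr_ne_zero K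
  haveI hEt : (W.quadraticTwist (NumberField.discr K : ℚ)).IsElliptic :=
    W.isElliptic_quadraticTwist hD0
  obtain ⟨Cd, hCd⟩ := hasGlobalMinimalModel_rat_holds (W.quadraticTwist (NumberField.discr K : ℚ))
  set Wd : WeierstrassCurve ℚ := Cd • W.quadraticTwist (NumberField.discr K : ℚ) with hWd_def
  haveI : Wd.IsGloballyMinimal := hCd
  have hWd : Cd • W.quadraticTwist (NumberField.discr K : ℚ) = Wd := rfl
  have hrt : (W.quadraticTwist (NumberField.discr K : ℚ)).analyticRank = 0 :=
    ((W.quadraticTwist _).analyticRank_eq_zero_iff_holds (hmod _)).2 hLt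
  have hrd : Wd.analyticRank = 0 := by rw [← hWd, analyticRank_smul, hrt]
  -- `K` is Heegner for `N_W`, and `p ∣ N_W` (additive) splits in `K`
  have hHN' : SatisfiesHeegnerHypothesis (W.conductorNorm ℤ) K := by rw [hN]; exact hHe
  have hpN : p ∣ W.conductorNorm ℤ :=
    (W.dvd_conductorNorm_iff_not_hasGoodReductionAtPrime p).mpr hX.2.1
  have hHp : SatisfiesHeegnerHypothesis p K := hHN'.of_dvd hpN
  -- the typed input gives the joint lower half over `(W, Wd)`
  have hJ : JointLowerBoundAt W Wd p := hIn W p hr hp2 hX hM K Wd hK hHN' hHp ⟨Cd, hWd⟩ hr hrd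
  -- and g3's converse of `JointLowerManin` gives STEP L over `K` at slack `v_p(c)`
  exact indexLowerBoundLeAt_of_jointLowerBoundAt W p N K Dt H ι P (hGZ N W K) (hKo N W K) hGZK hmod
    hGZ73 hr hN hK hodd hunit hHe hLt hP Wd ⟨Cd, hWd⟩ hp2 hJ

/-- **`PotMultBranchIMC` (BY NAME) ⇐ GZ, KO, GZK, MOD, GZ73 + the control crux + n1011's
`HeegnerInputAt` on the reducible rank-one (M) rows** (`stepL_subM_of_heegnerInput` composed with
door-c2 g2's `potMultBranchIMC_of_kolyvagin_of_control_of_stepL_subM`). CONDITIONAL; closes nothing; BSD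
is not proved by any of this. [cite: JetchevSkinnerWan2017, §7.4.1 (arXiv:1512.06894 p. 30)]
[cite: Gross1991, Thm. 1.3] -/
theorem potMultBranchIMC_of_control_of_heegnerInput
    (hGZ : ∀ (N : ℕ) [NeZero N] (W : WeierstrassCurve ℚ) (K : Type) [Field K] [NumberField K],
      gross_zagier N W K)
    (hKo : ∀ (N : ℕ) [NeZero N] (W : WeierstrassCurve ℚ) (K : Type) [Field K] [NumberField K],
      kolyvagin N W K)
    (hGZK : rank_eq_analyticRank_of_analyticRank_le_one) (hmod : hasEntireLFunction_rat)
    (hGZ73 : GrossZagier1986_thm_I_7_3)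
    (h4 : AnticycControlAdditiveK)
    (hIn : ∀ (W : WeierstrassCurve ℚ) [W.IsElliptic] [W.IsGloballyMinimal] (p : ℕ) [Fact p.Prime],
      W.analyticRank = 1 → p ≠ 2 → ClassX3 W p → Additive.SubM W p →
        Additive.Route3Anticyc.HeegnerInputAt W p) :
    PotMultBranchIMC :=
  potMultBranchIMC_of_kolyvagin_of_control_of_stepL_subM hKo (h4 hKo)
    (stepL_subM_of_heegnerInput hGZ hKo hGZK hmod hGZ73 hIn)

/-- **Ladder DAG edge, kernel form: `PrintedFacts + AnticycControlAdditiveK + (HeegnerInputAt on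
X3 ∧ (M) ∧ r_an = 1) ⟹ PotMultBranchIMC`.** Team n1011's typed missing input of its anticyclotomic
route r3 (Miller-currency joint lower half, «what a printed ⊇-divisibility WOULD give») implies the K1
door's crux r2 on the same census rows, modulo control and print. CONDITIONAL; closes nothing; BSD is
not proved by any of this. [cite: JetchevSkinnerWan2017, §7.4.1 (arXiv:1512.06894 p. 30)]
[cite: Miller2011LMS, Def. 1.1] -/
theorem potMultBranchIMC_of_printedFacts_of_control_of_heegnerInput (hF : PrintedFacts)
    (h4 : AnticycControlAdditiveK)
    (hIn : ∀ (W : WeierstrassCurve ℚ) [W.IsElliptic] [W.IsGloballyMinimal] (p : ℕ) [Fact p.Prime],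
      W.analyticRank = 1 → p ≠ 2 → ClassX3 W p → Additive.SubM W p →
        Additive.Route3Anticyc.HeegnerInputAt W p) :
    PotMultBranchIMC :=
  potMultBranchIMC_of_control_of_heegnerInput hF.1 hF.2.1 hF.2.2.1 hF.2.2.2.1 hF.2.2.2.2.2.2.1 h4 hIn

/-- **What r2 gives back to n1011's input: the joint lower half at every door datum.** For a
reducible rank-one (M) pair, a Heegner field `K` for `N_E` with ODD `d_K`, `p ∤ #𝓞_K^×`,
`L(E^{d_K},1) ≠ 0`, ANY parametrisation datum with its traced non-torsion Heegner point and ANY globally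
minimal model `Wd` of the twist of analytic rank zero: `PrintedFacts + PotMultBranchIMC +
AnticycControlAdditiveK ⟹ JointLowerBoundAt W Wd p` (STEP L from door-c2 g0's
`additiveStepLInputManinAt_of_kolyvagin_of_potMult_of_control`, then the route's PROVED item
`JointLowerManin`). This is `Route3Anticyc.HeegnerInputAt W p` on the door's fields only (odd `d_K`,
`p ∤ #𝓞_K^×`), not on every field that predicate quantifies over. CONDITIONAL; closes nothing.
[cite: JetchevSkinnerWan2017, §7.4.1 (arXiv:1512.06894 pp. 29–31)] [cite: GrossZagier1986, Thm. I.(6.3)] -/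
theorem jointLowerBoundAt_of_printedFacts_of_cruxes_at_datum (hF : PrintedFacts)
    (h2 : PotMultBranchIMC) (h4 : AnticycControlAdditiveK)
    (W : WeierstrassCurve ℚ) [W.IsElliptic] [W.IsGloballyMinimal] (p : ℕ) [Fact p.Prime]
    (hr : W.analyticRank = 1) (hp2 : p ≠ 2) (hX : ClassX3 W p) (hM : Additive.SubM W p)
    (N : ℕ) [NeZero N] (K : Type) [Field K] [NumberField K]
    (Dt : ModularParametrizationData W N) (H : HeegnerDatum N (NumberField.discr K)) (ι : K →+* ℂ)
    (P : (W.baseChange K).toAffine.Point)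
    (hN : W.conductorNorm ℤ = N) (hK : IsImaginaryQuadratic K) (hodd : Odd (NumberField.discr K))
    (hμ : ¬ p ∣ Units.torsionOrder K) (hHN : SatisfiesHeegnerHypothesis N K)
    (hLt : (W.quadraticTwist (NumberField.discr K : ℚ)).entireLFunction 1 ≠ 0)
    (hP : WeierstrassCurve.Affine.Point.map ι.toRatAlgHom P = heegnerPointComplex Dt H)
    (hnt : ¬ IsOfFinAddOrder P)
    (Wd : WeierstrassCurve ℚ) [Wd.IsElliptic] [Wd.IsGloballyMinimal]
    (hC : ∃ C : VariableChange ℚ, C • W.quadraticTwist (NumberField.discr K : ℚ) = Wd)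
    (hrd : Wd.analyticRank = 0) :
    JointLowerBoundAt W Wd p := by
  obtain ⟨hGZ, hKo, hGZK, hmod, hmodD, hCas, hGZ73, _hFH, _hpar, _hHP, _hDel, _hW16, _hWu⟩ := hF
  have hloc : Additive.N10.Locus W p := ⟨hp2, hX.2, Or.inl hM⟩
  have hI : IndexLowerBoundLeAt W p K P (padicValNat p Dt.c.natAbs) :=
    additiveStepLInputManinAt_of_kolyvagin_of_potMult_of_control hKo h2 (h4 hKo) W p hr hp2 hX hM N K
      Dt H ι P hr hloc hN hK hodd hμ hHN hLt hP hnt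
  exact (indexLowerBoundLeAt_iff_jointLowerBoundAt W p N K Dt H ι P hGZ hKo hGZK hmod hmodD hCas hGZ73
    hr hN hK hodd hμ hHN hLt hP hnt Wd hC hrd hp2).1 hI

end Summit.BirchSwinnertonDyer.BirchSwinnertonDyer.Theorems.SchneiderFree

end
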